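import Literature.MathematicalPhysics.QuantumFieldTheory.Balaban1983to89.Node00.BackgroundMapOfRecord

/-!
# NODE 00 — `BackgroundMapOfRecordChart`: the Sect. B∕C CHART MAP «A′ ↦ exp(iηA′)·U₀» ON THE WHOLE (115)-SPACE at the record's `BgScheme`,
# with `chart_sol : S.chart V (S.sol V) = S.chartCfg V` (by-name supply for the Summit-side P0 knit)

Cell `pub-ymgap` (YM-PLAN Track A), seat `pub-ymgap-node00-def-Y` (g35), 2026-08-31.  APPEND-ONLY new module importing `Node00/BackgroundMapOfRecord`
(✓p811606, untouched); count-neutral; `--supports stmt-QuantumFields-27238`.  [B11] = [Balaban1985Variational].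

WHY.  `Node00/BackgroundMapOfRecord` gives the chart image of the Prop. 6 fixed point AT the fixed point only (`BgScheme.chartCfg S V`).  The Summit-side
knit `Summits/…/BalabanUVNodesN07P0FixedPointIsRecordMinimiser` (dag-n07-w3, ✓p811578: `ukSel_eq_rootGauge_chart_solA`, `uniqueUkOrbit_chart_of_scheme`)
takes the chart as a FUNCTION `Φ' : 𝒴 → GaugeField (F.P K) 0 (SU N)` on the chart space, with its tokens (rng)(cov)(c→s)(min) quantified over chart
points.  This module supplies that function at the record's names and the `rfl` bridge to `chartCfg`.

WHAT IS CERTIFIED (kernel, sorry-free; `propext` ∕ `Classical.choice` ∕ `Quot.sound` only; no instance, no notation, nothing of Bałaban asserted):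
* `BgScheme.expoAt S V A b := exp(i · ev(A + 𝔄(V))(b))` and `BgScheme.chart S V : 𝒴 → GaugeField (F.P K) 0 (SU N)`, `chart S V A := (b ↦ suOfMat (expoAt S V A b) · U₀(b))`
  — the chart «U = U′U₀, U′ = exp(iηA′)» of (15) ∕ Sect. B (26)–(28) at a GENERAL chart point `A` (full small field `A′ = A + 𝔄`), read through the total
  retraction `suOfMat`;
* `expoAt_sol : S.expoAt V (S.sol V) = S.expo V`, ★ `chart_sol : S.chart V (S.sol V) = S.chartCfg V` (both `rfl`): instantiating the knit's `Φ'` with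
  `S.chart V` (and `𝒢 := S.𝒢 V, Λ := 0, W := S.W V, J := S.J V, 𝔄 := S.𝔄 V, ε₄ := S.ε₄`, so that its `solA …` is `S.sol V`) makes its conclusion read
  `UkSel F N K k ε V = rootGauge k (S.chartCfg V)`;
* `coe_chart_of_mem` (the retraction is transparent on `SU(N)`-valued exponents), the relation `IsChartImageAt S V A U` («U(b) = exp(i·ev(A + 𝔄)(b))·U₀(b)»)
  with `isChartImageAt_sol_iff : S.IsChartImageAt V (S.sol V) U ↔ S.IsChartImage V U`, `isChartImageAt_chart`, `IsChartImageAt.eq_chart`.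

HONEST SCOPE.  Names only (5 definitions∕lemmas, all `rfl`-grade); the knit's tokens and `Node00/BackgroundMapOfRecord`'s tokens remain displayed, OPEN
content; no continuum ∕ OS ∕ Clay statement is touched; the Yang–Mills mass gap is NOT proved by any of this.
-/

namespace Literature.MathematicalPhysics.QuantumFieldTheory.Balaban1983to89.Node00

open T4Continuum (T4Family)
open NormedSpace (exp)

namespace BgScheme

variable {F : T4Family} {N : ℕ} {𝒴 𝒵 : Type} [NormedAddCommGroup 𝒴] [NormedSpace ℂ 𝒴] [NormedAddCommGroup 𝒵] [NormedSpace ℂ 𝒵] {K k : ℕ}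
variable (S : BgScheme F N 𝒴 𝒵 K k)

/-- The exponent `exp(i X(b))`, `X = ev(A + 𝔄(V))`, at a GENERAL chart point `A` (full small field `A′ = A + 𝔄`). [cite: Balaban1985Variational, (15) p.280, (19) p.281] -/
noncomputable def expoAt (V : GaugeField (F.P K) k (SU N)) (A : 𝒴) (b : PBond (F.P K) 0) : Matrix (Fin N) (Fin N) ℂ :=
  exp (Complex.I • S.ev (A + S.𝔄 V) b)

/-- **THE CHART MAP AT THE RECORD** — «U = U′U₀, U′ = exp(iηA′)» as a function on the whole chart space `𝒴` at fixed coarse field `V`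
(background `U₀ = S.bg V`), read through the total retraction `suOfMat`. [cite: Balaban1985Variational, (15) p.280, (26)–(28) p.282] -/
noncomputable def chart (V : GaugeField (F.P K) k (SU N)) : 𝒴 → GaugeField (F.P K) 0 (SU N) :=
  fun A b => suOfMat N (S.expoAt V A b) * S.bg V b

/-- Unfolding of the chart map on a bond. [cite: Balaban1985Variational, (15) p.280] -/
theorem chart_apply (V : GaugeField (F.P K) k (SU N)) (A : 𝒴) (b : PBond (F.P K) 0) :
    S.chart V A b = suOfMat N (S.expoAt V A b) * S.bg V b := rfl

/-- At the fixed point the general exponent is the one of `Node00/BackgroundMapOfRecord`. [cite: Balaban1985Variational, Prop. 6 (116) p.295] -/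
theorem expoAt_sol (V : GaugeField (F.P K) k (SU N)) : S.expoAt V (S.sol V) = S.expo V := rfl

/-- ★ **The chart map at the fixed point IS the chart image of record**: `S.chart V (S.sol V) = S.chartCfg V`.
[cite: Balaban1985Variational, Prop. 6 (116) p.295, (15) p.280] -/
theorem chart_sol (V : GaugeField (F.P K) k (SU N)) : S.chart V (S.sol V) = S.chartCfg V := rfl

/-- The retraction is transparent on `SU(N)`-valued exponents: the matrix of `S.chart V A b` is `exp(iX(b)) · U₀(b)`. [cite: Balaban1985Variational, (15) p.280] -/
theorem coe_chart_of_mem {V : GaugeField (F.P K) k (SU N)} {A : 𝒴} {b : PBond (F.P K) 0}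
    (h : S.expoAt V A b ∈ Matrix.specialUnitaryGroup (Fin N) ℂ) :
    ((S.chart V A b : SU N) : Matrix (Fin N) (Fin N) ℂ) = S.expoAt V A b * ((S.bg V b : SU N) : Matrix (Fin N) (Fin N) ℂ) := by
  rw [chart_apply, suOfMat_of_mem h]
  rfl

/-- **THE CHART RELATION AT A GENERAL CHART POINT**: `U(b) = exp(i·ev(A + 𝔄(V))(b)) · U₀(b)` on every bond. [cite: Balaban1985Variational, (15) p.280, (26)–(28) p.282] -/
def IsChartImageAt (V : GaugeField (F.P K) k (SU N)) (A : 𝒴) (U : GaugeField (F.P K) 0 (SU N)) : Prop :=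
  ∀ b : PBond (F.P K) 0, ((U b : SU N) : Matrix (Fin N) (Fin N) ℂ) = S.expoAt V A b * ((S.bg V b : SU N) : Matrix (Fin N) (Fin N) ℂ)

/-- At the fixed point the general relation is `IsChartImage` of `Node00/BackgroundMapOfRecord`. [cite: Balaban1985Variational, Prop. 6 (116) p.295] -/
theorem isChartImageAt_sol_iff (V : GaugeField (F.P K) k (SU N)) (U : GaugeField (F.P K) 0 (SU N)) :
    S.IsChartImageAt V (S.sol V) U ↔ S.IsChartImage V U := Iff.rfl

/-- On `SU(N)`-valued exponents the chart map satisfies the chart relation. [cite: Balaban1985Variational, (15) p.280] -/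
theorem isChartImageAt_chart {V : GaugeField (F.P K) k (SU N)} {A : 𝒴} (h : ∀ b : PBond (F.P K) 0, S.expoAt V A b ∈ Matrix.specialUnitaryGroup (Fin N) ℂ) :
    S.IsChartImageAt V A (S.chart V A) :=
  fun b => S.coe_chart_of_mem (h b)

/-- A chart image at `A` is unique: it equals `S.chart V A`. [cite: Balaban1985Variational, (15) p.280] -/
theorem IsChartImageAt.eq_chart {V : GaugeField (F.P K) k (SU N)} {A : 𝒴} {U : GaugeField (F.P K) 0 (SU N)} (hU : S.IsChartImageAt V A U)
    (h : ∀ b : PBond (F.P K) 0, S.expoAt V A b ∈ Matrix.specialUnitaryGroup (Fin N) ℂ) : U = S.chart V A := by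
  funext b
  exact Subtype.ext ((hU b).trans (S.coe_chart_of_mem (h b)).symm)

end BgScheme

end Literature.MathematicalPhysics.QuantumFieldTheory.Balaban1983to89.Node00
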